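import Summits.BirchSwinnertonDyer.Rank1Residual.ManinAdditive.SigmaEtaKummer
import HarnessLib

/-!
# E-an-156 `ShimuraTwoCharIffFactorsThrough` — proof (an g35, T-an-37 Part A′)

TYPER NOTE (typer g19, TURNKEY T-an-37 v2, file C).  SOURCE = HOME/an/g35/ShimuraRadical-an-g35.lean sha16 a00c8b73f341a88f (158 l.; an:
farm rc 0 · 0 err · 0 warn · 2.0 s; `#print axioms isShimuraTwoChar_iff_factorsThrough` standard) VERBATIM except this note, one-line
docstrings on two undocumented helper lemmas, and an's helper `prod_primePow_dvd` demoted to a local `have` inside `radical_dvd_of_dvd_sq`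
(it restated the tree's `Literature…SzpiroOfAbc.prod_prime_pow_dvd` — gate `dedup.landed`; importing the abc cone for it was not worth it).  `isShimuraTwoChar_iff_factorsThrough` = the body of E-an-156 `SigmaTheta.ShimuraTwoCharIffFactorsThrough`
with `shimuraRadical N` unfolded; the by-name closure lives in `SigmaThetaHolds.lean`.  Theorem-only; nothing conjectured.
PARTITION 0 · beyond-print theorem: yes, modest (an) · BSD / C2 / Manin `c = 1` NOT proved by this.

For `4 ∣ N` (and trivially for `N = 0`), a `ℤ`-valued Dirichlet character `χ mod N` is a Shimura 2-character
(`IsShimuraTwoChar N χ`: even, killing every cusp stabiliser `1 + a·c·(N/gcd(N,c²))`, `c ∣ N`, `gcd(a,c) = 1`) iff it is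
even and factors through the radical `N₁ = ∏_{p ∣ N} p^{⌈v_p(N)/2⌉}`.  The radical is written out as its defining product,
so the by-name theorem over `SigmaTheta.shimuraRadical` is definitional transport (sibling `SigmaThetaHolds.lean`).

Proof: `N₁ ∣ N ∣ N₁²`; (→) the stabiliser with `a = 1`, `c = N₁` is `1 + N₁`, which generates the kernel
`{1 + k·N₁}` of `(ℤ/N)ˣ → (ℤ/N₁)ˣ` because `(1 + kN₁)(1 + N₁) ≡ 1 + (k+1)N₁ (mod N)`; (←) `N ∣ (c·w_c)²` forces `N₁ ∣ c·w_c`,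
so every stabiliser is `≡ 1 (mod N₁)`.
-/
namespace Summit.BirchSwinnertonDyer.Rank1Residual.ManinAdditive.SigmaEta

open Literature.NumberTheory.ModularForms
open Literature.NumberTheory.EllipticCurves.ModularForms
open scoped NumberTheorySymbols

/-! ### Arithmetic of the radical -/

/-- The Shimura radical `∏ p^{⌈v_p(N)/2⌉}` divides `N`. -/
theorem radical_dvd {N : ℕ} (hN : N ≠ 0) : (∏ p ∈ N.primeFactors, p ^ ((N.factorization p + 1) / 2)) ∣ N := by
  conv_rhs => rw [Nat.prod_primeFactors_pow_factorization hN]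
  exact Finset.prod_dvd_prod_of_dvd _ _ fun p _ => pow_dvd_pow p (by omega)

/-- `N` divides the square of its Shimura radical. -/
theorem dvd_radical_sq {N : ℕ} (hN : N ≠ 0) : N ∣ (∏ p ∈ N.primeFactors, p ^ ((N.factorization p + 1) / 2)) ^ 2 := by
  conv_lhs => rw [Nat.prod_primeFactors_pow_factorization hN]
  rw [← Finset.prod_pow]
  exact Finset.prod_dvd_prod_of_dvd _ _ fun p _ => by rw [← pow_mul]; exact pow_dvd_pow p (by omega)

/-- `N ∣ y² ⟹` the Shimura radical of `N` divides `y`. -/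
theorem radical_dvd_of_dvd_sq {N : ℕ} {y : ℕ} (h : N ∣ y ^ 2) :
    (∏ p ∈ N.primeFactors, p ^ ((N.factorization p + 1) / 2)) ∣ y := by
  rcases Nat.eq_zero_or_pos y with rfl | hy
  · exact dvd_zero _
  -- pairwise-coprime prime powers dividing `y` have product dividing `y` (the tree's
  -- `Literature…SzpiroOfAbc.prod_prime_pow_dvd`; kept as a local step so this leaf imports `SigmaEtaKummer` only)
  have key : ∀ (s : Finset ℕ), (∀ p ∈ s, p.Prime) → ∀ (e : ℕ → ℕ), (∀ p ∈ s, p ^ e p ∣ y) →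
      ∏ p ∈ s, p ^ e p ∣ y := by
    intro s hs e hd
    classical
    induction s using Finset.induction_on with
    | empty => simp
    | insert a r har ih =>
      rw [Finset.prod_insert har]
      refine Nat.Coprime.mul_dvd_of_dvd_of_dvd ?_ (hd a (Finset.mem_insert_self a r))
        (ih (fun p hp => hs p (Finset.mem_insert_of_mem hp)) (fun p hp => hd p (Finset.mem_insert_of_mem hp)))
      exact Nat.Coprime.prod_right fun p hp =>
        Nat.coprime_pow_primes _ _ (hs a (Finset.mem_insert_self a r)) (hs p (Finset.mem_insert_of_mem hp))
          (fun hap => har (hap ▸ hp))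
  refine key _ (fun p hp => Nat.prime_of_mem_primeFactors hp) _ fun p hp => ?_
  have hp' := Nat.prime_of_mem_primeFactors hp
  haveI := Fact.mk hp'
  have h1 : p ^ N.factorization p ∣ y ^ 2 := (Nat.ordProj_dvd N p).trans h
  have h2 := (padicValNat_dvd_iff_le (by positivity)).mp h1
  rw [padicValNat.pow y 2] at h2
  exact (padicValNat_dvd_iff_le hy.ne').mpr (by omega)

/-- `N ∣ (c · w_c)²` for the cusp width `w_c = N / gcd(N, c²)`. -/
theorem dvd_mul_width_sq (N c : ℕ) : N ∣ (c * (N / Nat.gcd N (c * c))) ^ 2 := by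
  obtain ⟨c', hc'⟩ := Nat.gcd_dvd_right N (c * c)
  have hgw : Nat.gcd N (c * c) * (N / Nat.gcd N (c * c)) = N := Nat.mul_div_cancel' (Nat.gcd_dvd_left _ _)
  refine ⟨c' * (N / Nat.gcd N (c * c)), ?_⟩
  calc (c * (N / Nat.gcd N (c * c))) ^ 2 = (c * c) * ((N / Nat.gcd N (c * c)) * (N / Nat.gcd N (c * c))) := by ring
    _ = (Nat.gcd N (c * c) * c') * ((N / Nat.gcd N (c * c)) * (N / Nat.gcd N (c * c))) := by rw [← hc']
    _ = (Nat.gcd N (c * c) * (N / Nat.gcd N (c * c))) * (c' * (N / Nat.gcd N (c * c))) := by ring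
    _ = N * (c' * (N / Nat.gcd N (c * c))) := by rw [hgw]

/-- The cusp stabiliser `1 + a·c·w_c` is coprime to `N`. -/
theorem coprime_cusp_stabiliser (N a c : ℕ) : Nat.Coprime (1 + a * c * (N / Nat.gcd N (c * c))) N := by
  have h1 : Nat.Coprime (1 + a * (c * (N / Nat.gcd N (c * c)))) (c * (N / Nat.gcd N (c * c))) := by
    rw [show 1 + a * (c * (N / Nat.gcd N (c * c))) = 1 + (c * (N / Nat.gcd N (c * c))) * a by ring]
    exact (Nat.coprime_add_mul_left_left 1 _ a).mpr (Nat.coprime_one_left _)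
  rw [show 1 + a * c * (N / Nat.gcd N (c * c)) = 1 + a * (c * (N / Nat.gcd N (c * c))) by ring]
  exact Nat.Coprime.coprime_dvd_right (dvd_mul_width_sq N c) (h1.pow_right 2)

/-! ### E-an-156 -/

/-- **E-an-156, statement spelled out** (the body of `SigmaTheta.ShimuraTwoCharIffFactorsThrough` with `shimuraRadical N`
unfolded): a Shimura 2-character is exactly an even character through the radical. -/
theorem isShimuraTwoChar_iff_factorsThrough (N : ℕ) (h4N : 4 ∣ N) (χ : DirichletCharacter ℤ N) :
    IsShimuraTwoChar N χ ↔
      (χ (-1) = 1 ∧ χ.FactorsThrough (∏ p ∈ N.primeFactors, p ^ ((N.factorization p + 1) / 2))) := by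
  rcases Nat.eq_zero_or_pos N with rfl | hNpos
  · -- `N = 0`: `ZMod 0 = ℤ`, radical `= 1`, both sides say `χ (-1) = 1`
    simp only [Nat.primeFactors_zero, Finset.prod_empty, DirichletCharacter.factorsThrough_one_iff]
    constructor
    · rintro ⟨hev, -⟩
      refine ⟨hev, MulChar.ext fun u => ?_⟩
      rw [MulChar.one_apply_coe]
      rcases Int.units_eq_one_or u with rfl | rfl
      · show χ ((1 : (ZMod 0)ˣ) : ZMod 0) = 1
        rw [Units.val_one, map_one]
      · show χ ((-1 : (ZMod 0)ˣ) : ZMod 0) = 1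
        rw [Units.val_neg, Units.val_one]; exact hev
    · rintro ⟨hev, -⟩
      exact ⟨hev, fun a c _ _ => by simp⟩
  haveI : NeZero N := ⟨hNpos.ne'⟩
  set N₁ := ∏ p ∈ N.primeFactors, p ^ ((N.factorization p + 1) / 2) with hN₁
  have hd : N₁ ∣ N := radical_dvd hNpos.ne'
  have hsq : N ∣ N₁ ^ 2 := dvd_radical_sq hNpos.ne'
  have hN₁pos : 0 < N₁ := Nat.pos_of_dvd_of_pos hd hNpos
  have hN₁2 : 2 ≤ N₁ := by
    refine Nat.le_of_dvd hN₁pos ?_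
    have h2mem : 2 ∈ N.primeFactors :=
      Nat.mem_primeFactors.mpr ⟨Nat.prime_two, (dvd_trans ⟨2, rfl⟩ h4N), hNpos.ne'⟩
    refine dvd_trans ?_ (Finset.dvd_prod_of_mem _ h2mem)
    have hv : 0 < N.factorization 2 := Nat.Prime.factorization_pos_of_dvd Nat.prime_two hNpos.ne' (dvd_trans ⟨2, rfl⟩ h4N)
    exact dvd_pow_self 2 (by omega)
  rw [DirichletCharacter.factorsThrough_iff_ker_unitsMap hd]
  constructor
  · rintro ⟨hev, hcusp⟩
    refine ⟨hev, fun u hu => ?_⟩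
    have hx : (u : ZMod N).val ≡ 1 [MOD N₁] := by
      have h := hu
      rwa [MonoidHom.mem_ker, Units.ext_iff, ZMod.unitsMap_val, ← ZMod.natCast_val, Units.val_one, ← Nat.cast_one,
        ZMod.natCast_eq_natCast_iff] at h
    have hgen : χ ((1 + N₁ : ℕ) : ZMod N) = 1 := by
      have h := hcusp 1 N₁ hd (Nat.coprime_one_left _)
      have hg : Nat.gcd N (N₁ * N₁) = N := Nat.gcd_eq_left (by rw [← pow_two]; exact hsq)
      rwa [hg, Nat.div_self hNpos, one_mul, mul_one] at h
    have hall : ∀ k : ℕ, χ ((1 + k * N₁ : ℕ) : ZMod N) = 1 := by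
      intro k
      induction k with
      | zero => simp
      | succ k ih =>
        have h0 : ((N₁ : ZMod N)) ^ 2 = 0 := by
          obtain ⟨e, he⟩ := hsq
          rw [← Nat.cast_pow, he, Nat.cast_mul, ZMod.natCast_self, zero_mul]
        have hmul : ((1 + (k + 1) * N₁ : ℕ) : ZMod N) = ((1 + k * N₁ : ℕ) : ZMod N) * ((1 + N₁ : ℕ) : ZMod N) := by
          push_cast
          linear_combination (-(k : ZMod N)) * h0
        rw [hmul, map_mul, ih, hgen, one_mul]
    rw [MonoidHom.mem_ker, Units.ext_iff, MulChar.coe_toUnitHom, Units.val_one]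
    obtain ⟨k, hk⟩ : ∃ k, (u : ZMod N).val = 1 + k * N₁ := by
      refine ⟨(u : ZMod N).val / N₁, ?_⟩
      have h := Nat.div_add_mod ((u : ZMod N).val) N₁
      rw [Nat.ModEq, Nat.mod_eq_of_lt (by omega : 1 < N₁)] at hx
      rw [hx, mul_comm] at h
      linarith
    rw [← ZMod.natCast_zmod_val (u : ZMod N), hk]
    exact hall k
  · rintro ⟨hev, hker⟩
    refine ⟨hev, fun a c _ _ => ?_⟩
    have hN₁cw : N₁ ∣ c * (N / Nat.gcd N (c * c)) := radical_dvd_of_dvd_sq (dvd_mul_width_sq N c)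
    have hcop := coprime_cusp_stabiliser N a c
    have hu : ZMod.unitOfCoprime _ hcop ∈ (ZMod.unitsMap hd).ker := by
      rw [MonoidHom.mem_ker, Units.ext_iff, ZMod.unitsMap_val, ZMod.coe_unitOfCoprime, ZMod.cast_natCast hd,
        Units.val_one]
      obtain ⟨e, he⟩ := hN₁cw
      rw [show 1 + a * c * (N / Nat.gcd N (c * c)) = 1 + a * (c * (N / Nat.gcd N (c * c))) by ring, he]
      push_cast
      rw [ZMod.natCast_self, zero_mul, mul_zero, add_zero]
    have h := hker hu
    rw [MonoidHom.mem_ker, Units.ext_iff, MulChar.coe_toUnitHom, Units.val_one, ZMod.coe_unitOfCoprime] at h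
    exact h

end Summit.BirchSwinnertonDyer.Rank1Residual.ManinAdditive.SigmaEta
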